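import Mathlib
import Summits.Ventures.HodgeRepro.Tier4.Target
import Summits.Ventures.HodgeRepro.Tier4.Line3.Defs
import Summits.Ventures.HodgeRepro.Tier4.Line3.DefsLemmas
import Summits.Ventures.HodgeRepro.Tier4.Line3.ClassBoundGauss
import Summits.Ventures.HodgeRepro.Tier4.Line3.GaussRatioFormula
import Summits.Ventures.HodgeRepro.Tier4.Line3.CopyWeightGaussian
import Summits.Ventures.HodgeRepro.Tier4.Line3.CopyWeightBoundShrink
import Summits.Ventures.HodgeRepro.Tier4.Line3.IntegralScalarExcess
import Summits.Ventures.HodgeRepro.Tier4.Line3.LatticeGaussSummable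

/-!
# Tier4/Line3/ShrinkMajGauss — the shrinking majorant of an INTEGRAL copy is Gaussian in the houses of its scalars

Blind re-derivation cell `pub-hodge-repro`, Tier 4 «PROVE THE STEP», LINE L3, seat t4-x2 (g3, reserve wall-breaker); the
Gaussian domination announced on bus S13961 (i).  For the closed-form majorant of CopyWeightBoundShrink,

  `shrinkMaj A k ε xm = A · ∏_j t_j² · ∏_j (min 1 t_j²)^{−k} · exp(−π Σ_j (t_j² − 1)⁺ tauSize (xm j)) · exp(−π defSize ε xm)`,

the danger is the SHRINKING factor `(min 1 t_j²)^{−k}`, unbounded as `t_j = ‖τ₀ ε_j‖ → 0`.  For an ALGEBRAIC INTEGER `ε_j ≠ 0`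
the product formula `t_j² · ∏_{σ def} ‖σ ε_j‖ ≥ 1` (IntegralScalarExcess `one_le_prod_norm_emb`) makes `t_j^{−2}` a
polynomial in the definite sizes, which the definite Gaussian `exp(−π Σ_σ (‖σ ε_j‖² − 1) defQuad σ (xm j))` absorbs when
every definite size of the centre is positive; the `τ₀`-Gaussian `exp(−π (t_j² − 1)⁺ tauSize (xm j))` absorbs `t_j²`
when `tauSize (xm j) > 0` (anisotropy).  Hence, per slot (`slot_gauss_bound`, pure real analysis) and for the 4-slot
majorant (`shrinkMaj_le_gauss`):

  `shrinkMaj A k ε xm ≤ C · exp(−κ · Σ_j ‖mixedEmbedding X.E (ε j)‖²)`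

for every tuple of non-zero algebraic integers, with `κ = (π/2) · min(min_j tauSize (xm j), q_min) > 0` (`q_min` a positive
lower bound of the definite sizes `defQuad σ (xm j)`) and a constant `C` depending on `(A, k, xm)` only.  With
CopyCountSummable `summable_copyCount_of_gauss` this is the `Summable` half of v0.44's pure count for the majorant
`c.majHK A k` on integral admissible scalars with bounded phases (`‖Λ(o)‖ ≤ Λ₀`): `summable_copyCount_shrinkMaj`.

Nothing here says anything about the status of the Hodge conjecture for CM abelian varieties, which is NOT proved
(HC_CM is NOT proved by anyone in this repository).
-/

set_option autoImplicit false

noncomputable section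

namespace Summit.Ventures.HodgeRepro.Tier4.Line3

open Summit.Ventures.HodgeRepro.Tier4
open NumberField NumberField.mixedEmbedding
open scoped Classical

/-! ## A. Real analysis: the per-slot bound -/

/-- `x · exp(−x) ≤ 1` for `x ≥ 0`. -/
theorem mul_exp_neg_le_one (x : ℝ) : x * Real.exp (-x) ≤ 1 := by
  have h1 : x + 1 ≤ Real.exp x := Real.add_one_le_exp x
  have h2 : 0 < Real.exp x := Real.exp_pos x
  rw [Real.exp_neg, mul_inv_le_iff₀ h2, one_mul]
  linarith

/-- The `τ₀`-factor of a slot: `t² · exp(−π (t² − 1)⁺ h) ≤ e^{πh} (1 + 2/(πh)) · exp(−(πh/2) t²)` for `t > 0`, `h > 0`. -/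
theorem tau_factor_le {t h : ℝ} (ht : 0 < t) (hh : 0 < h) :
    t ^ 2 * Real.exp (-(Real.pi * (max 0 (t ^ 2 - 1) * h))) ≤
      Real.exp (Real.pi * h) * (1 + 2 / (Real.pi * h)) * Real.exp (-(Real.pi * h / 2 * t ^ 2)) := by
  have hπh : 0 < Real.pi * h := mul_pos Real.pi_pos hh
  have hA : 0 < Real.exp (Real.pi * h) * (1 + 2 / (Real.pi * h)) := by positivity
  rcases le_or_gt 1 (t ^ 2) with h1 | h1
  · -- non-shrinking: the full Gaussian, with `y e^{−y} ≤ 1` at `y = (πh/2) t²`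
    rw [max_eq_right (by linarith)]
    have hy : t ^ 2 * Real.exp (-(Real.pi * h / 2 * t ^ 2)) ≤ 2 / (Real.pi * h) := by
      have h0 := mul_exp_neg_le_one (Real.pi * h / 2 * t ^ 2)
      have h2 : t ^ 2 * Real.exp (-(Real.pi * h / 2 * t ^ 2)) =
          (2 / (Real.pi * h)) * (Real.pi * h / 2 * t ^ 2 * Real.exp (-(Real.pi * h / 2 * t ^ 2))) := by
        field_simp
      rw [h2]
      calc (2 / (Real.pi * h)) * (Real.pi * h / 2 * t ^ 2 * Real.exp (-(Real.pi * h / 2 * t ^ 2)))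
          ≤ (2 / (Real.pi * h)) * 1 := by gcongr
        _ = 2 / (Real.pi * h) := mul_one _
    have hsplit : Real.exp (-(Real.pi * ((t ^ 2 - 1) * h))) =
        Real.exp (Real.pi * h) * (Real.exp (-(Real.pi * h / 2 * t ^ 2)) * Real.exp (-(Real.pi * h / 2 * t ^ 2))) := by
      rw [← Real.exp_add, ← Real.exp_add]
      congr 1
      ring
    rw [hsplit]
    calc t ^ 2 * (Real.exp (Real.pi * h) * (Real.exp (-(Real.pi * h / 2 * t ^ 2)) *
          Real.exp (-(Real.pi * h / 2 * t ^ 2))))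
        = Real.exp (Real.pi * h) * (t ^ 2 * Real.exp (-(Real.pi * h / 2 * t ^ 2))) *
          Real.exp (-(Real.pi * h / 2 * t ^ 2)) := by ring
      _ ≤ Real.exp (Real.pi * h) * (2 / (Real.pi * h)) * Real.exp (-(Real.pi * h / 2 * t ^ 2)) := by gcongr
      _ ≤ Real.exp (Real.pi * h) * (1 + 2 / (Real.pi * h)) * Real.exp (-(Real.pi * h / 2 * t ^ 2)) := by
          gcongr
          linarith
  · -- shrinking: `t² < 1`, the factor is `t² ≤ 1 ≤ e^{πh/2} ≤ RHS`
    rw [max_eq_left (by linarith)]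
    simp only [zero_mul, mul_zero, neg_zero, Real.exp_zero, mul_one]
    have h2 : Real.exp (-(Real.pi * h / 2)) ≤ Real.exp (-(Real.pi * h / 2 * t ^ 2)) := by
      apply Real.exp_le_exp.2
      nlinarith [sq_nonneg t]
    have h3 : 1 ≤ Real.exp (Real.pi * h) * (1 + 2 / (Real.pi * h)) * Real.exp (-(Real.pi * h / 2)) := by
      have h4 : Real.exp (Real.pi * h) * Real.exp (-(Real.pi * h / 2)) = Real.exp (Real.pi * h / 2) := by
        rw [← Real.exp_add]; congr 1; ring
      have h5 : 1 ≤ Real.exp (Real.pi * h / 2) := Real.one_le_exp (by positivity)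
      have h6 : 1 ≤ 1 + 2 / (Real.pi * h) := by
        have : 0 ≤ 2 / (Real.pi * h) := by positivity
        linarith
      calc (1 : ℝ) = 1 * 1 := (mul_one 1).symm
        _ ≤ Real.exp (Real.pi * h / 2) * (1 + 2 / (Real.pi * h)) := mul_le_mul h5 h6 zero_le_one (by positivity)
        _ = Real.exp (Real.pi * h) * (1 + 2 / (Real.pi * h)) * Real.exp (-(Real.pi * h / 2)) := by
          rw [← h4]; ring
    calc t ^ 2 ≤ 1 := h1.le
      _ ≤ Real.exp (Real.pi * h) * (1 + 2 / (Real.pi * h)) * Real.exp (-(Real.pi * h / 2)) := h3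
      _ ≤ Real.exp (Real.pi * h) * (1 + 2 / (Real.pi * h)) * Real.exp (-(Real.pi * h / 2 * t ^ 2)) := by gcongr

/-- Polynomial against exponential: `(1 + P)^b · exp(−λ P) ≤ (n! / λⁿ) · e^{λ}` with `n = ⌈b⌉₊`, for `P ≥ 0`, `b ≥ 0`, `λ > 0`. -/
theorem rpow_mul_exp_neg_le {P b lam : ℝ} (hP : 0 ≤ P) (hlam : 0 < lam) :
    (1 + P) ^ b * Real.exp (-(lam * P)) ≤ ((⌈b⌉₊.factorial : ℝ) / lam ^ ⌈b⌉₊) * Real.exp lam := by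
  set n : ℕ := ⌈b⌉₊ with hn
  have h1P : 1 ≤ 1 + P := by linarith
  have hpow : (1 + P) ^ b ≤ (1 + P) ^ n := by
    rw [← Real.rpow_natCast]
    exact Real.rpow_le_rpow_of_exponent_le h1P (Nat.le_ceil b)
  have hexp : (lam * (1 + P)) ^ n / (n.factorial : ℝ) ≤ Real.exp (lam * (1 + P)) :=
    Real.pow_div_factorial_le_exp _ (by positivity) n
  have hfac : (0 : ℝ) < n.factorial := by exact_mod_cast n.factorial_pos
  have hlamn : 0 < lam ^ n := pow_pos hlam n
  -- `(1 + P)^n ≤ (n!/λⁿ) · exp(λ (1 + P))`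
  have h2 : (1 + P) ^ n ≤ ((n.factorial : ℝ) / lam ^ n) * Real.exp (lam * (1 + P)) := by
    rw [mul_pow] at hexp
    rw [div_le_iff₀ hfac] at hexp
    rw [div_mul_eq_mul_div, le_div_iff₀ hlamn]
    linarith
  calc (1 + P) ^ b * Real.exp (-(lam * P)) ≤ (1 + P) ^ n * Real.exp (-(lam * P)) := by
        gcongr
    _ ≤ ((n.factorial : ℝ) / lam ^ n) * Real.exp (lam * (1 + P)) * Real.exp (-(lam * P)) := by
        gcongr
    _ = ((n.factorial : ℝ) / lam ^ n) * Real.exp lam := by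
        rw [mul_assoc, ← Real.exp_add]
        congr 2
        ring

/-- The shrinking factor is absorbed by the definite sizes: for `t > 0` with `1 ≤ t² ∏_{σ ∈ sd} u σ` (`u ≥ 0`),
`(min 1 t²)^{−k} ≤ (1 + Σ_σ u σ²)^{|Σ| · k}`. -/
theorem shrink_factor_le {ι : Type} (sd : Finset ι) {t k : ℝ} (ht : 0 < t) (hk : 0 ≤ k) (u : ι → ℝ)
    (hu : ∀ σ ∈ sd, 0 ≤ u σ) (hnorm : 1 ≤ t ^ 2 * ∏ σ ∈ sd, u σ) :
    (min 1 (t ^ 2)) ^ (-k) ≤ (1 + ∑ σ ∈ sd, u σ ^ 2) ^ ((sd.card : ℝ) * k) := by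
  set P : ℝ := ∑ σ ∈ sd, u σ ^ 2 with hP
  have hP0 : 0 ≤ P := Finset.sum_nonneg fun σ _ => sq_nonneg _
  have h1P : 1 ≤ 1 + P := by linarith
  rcases le_or_gt 1 (t ^ 2) with h1 | h1
  · rw [min_eq_left h1, Real.one_rpow]
    exact Real.one_le_rpow h1P (by positivity)
  · rw [min_eq_right h1.le]
    have ht2 : 0 < t ^ 2 := by positivity
    -- `(t²)^{−k} = ((t²)⁻¹)^k` and `(t²)⁻¹ ≤ ∏ u σ ≤ (1 + P)^{|Σ|}`
    have hinv : (t ^ 2)⁻¹ ≤ ∏ σ ∈ sd, u σ := by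
      rw [inv_le_iff_one_le_mul₀ ht2, mul_comm]
      exact hnorm
    have hprod : ∏ σ ∈ sd, u σ ≤ (1 + P) ^ sd.card := by
      calc ∏ σ ∈ sd, u σ ≤ ∏ σ ∈ sd, (1 + P) := by
            refine Finset.prod_le_prod (fun σ hσ => hu σ hσ) fun σ hσ => ?_
            have hsq : u σ ^ 2 ≤ P := Finset.single_le_sum (fun τ _ => sq_nonneg (u τ)) hσ
            nlinarith [hu σ hσ, sq_nonneg (u σ - 1)]
        _ = (1 + P) ^ sd.card := Finset.prod_const _
    have hbase : (t ^ 2)⁻¹ ≤ (1 + P) ^ sd.card := hinv.trans hprod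
    rw [Real.rpow_neg ht2.le, ← Real.inv_rpow ht2.le]
    calc ((t ^ 2)⁻¹) ^ k ≤ ((1 + P) ^ sd.card) ^ k := Real.rpow_le_rpow (by positivity) hbase hk
      _ = (1 + P) ^ ((sd.card : ℝ) * k) := by
          rw [← Real.rpow_natCast, ← Real.rpow_mul (by linarith)]

/-- The definite factor: `exp(−π Σ_σ (u σ² − 1) q σ) ≤ e^{π Q} · exp(−π q_min P)` for `q ≥ q_min` on `Σ`. -/
theorem def_factor_le {ι : Type} (sd : Finset ι) (u q : ι → ℝ) {qm : ℝ} (hq : ∀ σ ∈ sd, qm ≤ q σ) :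
    Real.exp (-(Real.pi * ∑ σ ∈ sd, (u σ ^ 2 - 1) * q σ)) ≤
      Real.exp (Real.pi * ∑ σ ∈ sd, q σ) * Real.exp (-(Real.pi * qm * ∑ σ ∈ sd, u σ ^ 2)) := by
  rw [← Real.exp_add]
  apply Real.exp_le_exp.2
  have h1 : qm * ∑ σ ∈ sd, u σ ^ 2 ≤ ∑ σ ∈ sd, u σ ^ 2 * q σ := by
    rw [Finset.mul_sum]
    refine Finset.sum_le_sum fun σ hσ => ?_
    rw [mul_comm]
    exact mul_le_mul_of_nonneg_left (hq σ hσ) (sq_nonneg _)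
  have h2 : ∑ σ ∈ sd, (u σ ^ 2 - 1) * q σ = (∑ σ ∈ sd, u σ ^ 2 * q σ) - ∑ σ ∈ sd, q σ := by
    rw [← Finset.sum_sub_distrib]
    refine Finset.sum_congr rfl fun σ _ => ?_
    ring
  rw [h2]
  nlinarith [Real.pi_pos, h1]

/-- **THE PER-SLOT GAUSSIAN BOUND.** For `t > 0`, `h > 0`, definite weights `q ≥ q_min > 0` on `Σ`, `k ≥ 0`, and the
product formula `1 ≤ t² ∏_{σ ∈ sd} u σ` (`u ≥ 0`): with `κ ≤ πh/2` and `κ ≤ π q_min/2`,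
`t² (min 1 t²)^{−k} exp(−π (t²−1)⁺ h) exp(−π Σ_σ (u σ² − 1) q σ) ≤ C · exp(−κ (t² + Σ_σ u σ²))`, `C` independent of `t, u`. -/
theorem slot_gauss_bound {ι : Type} (sd : Finset ι) {h qm k κ : ℝ} (hh : 0 < h) (hqm : 0 < qm) (hk : 0 ≤ k)
    (hκh : κ ≤ Real.pi * h / 2) (hκq : κ ≤ Real.pi * qm / 2) (q : ι → ℝ) (hq : ∀ σ ∈ sd, qm ≤ q σ) :
    ∃ C : ℝ, 0 ≤ C ∧ ∀ (t : ℝ) (u : ι → ℝ), 0 < t → (∀ σ ∈ sd, 0 ≤ u σ) → 1 ≤ t ^ 2 * ∏ σ ∈ sd, u σ →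
      t ^ 2 * (min 1 (t ^ 2)) ^ (-k) * Real.exp (-(Real.pi * (max 0 (t ^ 2 - 1) * h))) *
        Real.exp (-(Real.pi * ∑ σ ∈ sd, (u σ ^ 2 - 1) * q σ)) ≤
      C * Real.exp (-(κ * (t ^ 2 + ∑ σ ∈ sd, u σ ^ 2))) := by
  set b : ℝ := (sd.card : ℝ) * k with hb
  set lam : ℝ := Real.pi * qm / 2 with hlam
  have hlam0 : 0 < lam := by positivity
  refine ⟨Real.exp (Real.pi * h) * (1 + 2 / (Real.pi * h)) * (Real.exp (Real.pi * ∑ σ ∈ sd, q σ) *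
    (((⌈b⌉₊.factorial : ℝ) / lam ^ ⌈b⌉₊) * Real.exp lam)), by positivity, ?_⟩
  intro t u ht hu hnorm
  set P : ℝ := ∑ σ ∈ sd, u σ ^ 2 with hP
  have hP0 : 0 ≤ P := Finset.sum_nonneg fun σ _ => sq_nonneg _
  have hτ := tau_factor_le ht hh
  have hsh := shrink_factor_le sd ht hk u hu hnorm
  have hdef := def_factor_le sd u q hq
  have hpoly := rpow_mul_exp_neg_le (P := P) (b := b) (lam := lam) hP0 hlam0
  -- split the definite Gaussian `exp(−π q_min P) = exp(−λ P) · exp(−λ P)`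
  have hsplit : Real.exp (-(Real.pi * qm * P)) = Real.exp (-(lam * P)) * Real.exp (-(lam * P)) := by
    rw [← Real.exp_add]; congr 1; rw [hlam]; ring
  -- the two decays against `κ`
  have hdec1 : Real.exp (-(Real.pi * h / 2 * t ^ 2)) ≤ Real.exp (-(κ * t ^ 2)) := by
    apply Real.exp_le_exp.2
    nlinarith [sq_nonneg t]
  have hdec2 : Real.exp (-(lam * P)) ≤ Real.exp (-(κ * P)) := by
    apply Real.exp_le_exp.2
    rw [hlam]
    nlinarith
  have hsh0 : 0 ≤ (min 1 (t ^ 2)) ^ (-k) := Real.rpow_nonneg (by positivity) _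
  have hτ0 : 0 ≤ t ^ 2 * Real.exp (-(Real.pi * (max 0 (t ^ 2 - 1) * h))) := by positivity
  have hB0 : 0 ≤ (1 + P) ^ b := Real.rpow_nonneg (by linarith) _
  calc t ^ 2 * (min 1 (t ^ 2)) ^ (-k) * Real.exp (-(Real.pi * (max 0 (t ^ 2 - 1) * h))) *
        Real.exp (-(Real.pi * ∑ σ ∈ sd, (u σ ^ 2 - 1) * q σ))
      = (t ^ 2 * Real.exp (-(Real.pi * (max 0 (t ^ 2 - 1) * h)))) * (min 1 (t ^ 2)) ^ (-k) *
        Real.exp (-(Real.pi * ∑ σ ∈ sd, (u σ ^ 2 - 1) * q σ)) := by ring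
    _ ≤ (Real.exp (Real.pi * h) * (1 + 2 / (Real.pi * h)) * Real.exp (-(Real.pi * h / 2 * t ^ 2))) *
        (1 + P) ^ b * (Real.exp (Real.pi * ∑ σ ∈ sd, q σ) * Real.exp (-(Real.pi * qm * P))) := by
          gcongr
    _ = Real.exp (Real.pi * h) * (1 + 2 / (Real.pi * h)) * Real.exp (Real.pi * ∑ σ ∈ sd, q σ) *
        ((1 + P) ^ b * Real.exp (-(lam * P))) * (Real.exp (-(Real.pi * h / 2 * t ^ 2)) * Real.exp (-(lam * P))) := by
          rw [hsplit]; ring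
    _ ≤ Real.exp (Real.pi * h) * (1 + 2 / (Real.pi * h)) * Real.exp (Real.pi * ∑ σ ∈ sd, q σ) *
        (((⌈b⌉₊.factorial : ℝ) / lam ^ ⌈b⌉₊) * Real.exp lam) *
        (Real.exp (-(κ * t ^ 2)) * Real.exp (-(κ * P))) := by
          gcongr
    _ = Real.exp (Real.pi * h) * (1 + 2 / (Real.pi * h)) * (Real.exp (Real.pi * ∑ σ ∈ sd, q σ) *
        (((⌈b⌉₊.factorial : ℝ) / lam ^ ⌈b⌉₊) * Real.exp lam)) * Real.exp (-(κ * (t ^ 2 + P))) := by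
          rw [← Real.exp_add]
          congr 1
          · ring
          · congr 1; ring


/-! ## B. The 4-slot majorant on integral scalars -/

namespace T4Data

variable (X : T4Data)

/-- The definite embeddings (the index set of `defSize`). -/
def defEmb : Finset (X.E →+* ℂ) := Finset.univ.filter (fun σ : X.E →+* ℂ => σ ≠ X.τ₀ ∧ σ ≠ conjEmb X.τ₀)

/-- `conjEmb` is Mathlib's conjugate embedding. -/
theorem conjEmb_tau_eq_conjugate : conjEmb X.τ₀ = ComplexEmbedding.conjugate X.τ₀ := by
  ext x
  rfl

/-- `τ₀` is not real (the CM field is totally complex): `τ₀ ≠ τ̄₀`. -/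
theorem tau_ne_conjEmb : X.τ₀ ≠ conjEmb X.τ₀ := by
  intro h
  have hnr : ¬ ComplexEmbedding.IsReal X.τ₀ := IsTotallyComplex.complexEmbedding_not_isReal X.τ₀
  apply hnr
  rw [ComplexEmbedding.isReal_iff, ← X.conjEmb_tau_eq_conjugate]
  exact h.symm

/-- The complement of the definite embeddings is the pair `{τ₀, τ̄₀}`. -/
theorem filter_not_def_eq : (Finset.univ.filter (fun σ : X.E →+* ℂ => ¬(σ ≠ X.τ₀ ∧ σ ≠ conjEmb X.τ₀))) =
    {X.τ₀, conjEmb X.τ₀} := by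
  ext σ
  simp only [Finset.mem_filter, Finset.mem_univ, true_and, not_and_or, not_not, Finset.mem_insert,
    Finset.mem_singleton]

/-- **THE PRODUCT FORMULA OVER THE SLOT SIZES**: `1 ≤ ‖τ₀ x‖² · ∏_{σ def} ‖σ x‖` for a non-zero algebraic integer. -/
theorem one_le_tau_sq_mul_prod_def {x : X.E} (hx : IsIntegral ℤ x) (h0 : x ≠ 0) :
    1 ≤ ‖X.τ₀ x‖ ^ 2 * ∏ σ ∈ X.defEmb, ‖σ x‖ := by
  have h := one_le_prod_norm_emb hx h0
  rw [← Finset.prod_filter_mul_prod_filter_not Finset.univ (fun σ : X.E →+* ℂ => σ ≠ X.τ₀ ∧ σ ≠ conjEmb X.τ₀),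
    X.filter_not_def_eq, Finset.prod_pair X.tau_ne_conjEmb, X.norm_conjEmb_tau] at h
  calc (1 : ℝ) ≤ (∏ σ ∈ Finset.univ.filter (fun σ : X.E →+* ℂ => σ ≠ X.τ₀ ∧ σ ≠ conjEmb X.τ₀), ‖σ x‖) *
        (‖X.τ₀ x‖ * ‖X.τ₀ x‖) := h
    _ = ‖X.τ₀ x‖ ^ 2 * ∏ σ ∈ X.defEmb, ‖σ x‖ := by
        unfold defEmb
        ring

/-- **THE HOUSE IS BOUNDED BY THE SLOT SIZES**: `‖mixedEmbedding x‖² ≤ ‖τ₀ x‖² + Σ_{σ def} ‖σ x‖²`. -/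
theorem mixed_norm_sq_le (x : X.E) :
    ‖mixedEmbedding X.E x‖ ^ 2 ≤ ‖X.τ₀ x‖ ^ 2 + ∑ σ ∈ X.defEmb, ‖σ x‖ ^ 2 := by
  obtain ⟨w, -, hw⟩ := Finset.exists_mem_eq_sup' Finset.univ_nonempty
    (fun w : InfinitePlace X.E => normAtPlace w (mixedEmbedding X.E x))
  rw [norm_eq_sup'_normAtPlace, hw, normAtPlace_apply, ← InfinitePlace.norm_embedding_eq]
  have hsum0 : 0 ≤ ∑ σ ∈ X.defEmb, ‖σ x‖ ^ 2 := Finset.sum_nonneg fun _ _ => sq_nonneg _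
  by_cases hσ : w.embedding ∈ X.defEmb
  · exact le_add_of_nonneg_of_le (sq_nonneg _) (Finset.single_le_sum (fun τ _ => sq_nonneg (‖τ x‖)) hσ)
  · have h2 : w.embedding = X.τ₀ ∨ w.embedding = conjEmb X.τ₀ := by
      simpa only [defEmb, Finset.mem_filter, Finset.mem_univ, true_and, not_and_or, not_not] using hσ
    rcases h2 with h | h
    · rw [h]
      linarith
    · rw [h, X.norm_conjEmb_tau]
      linarith

/-- The per-slot factor of the shrinking majorant. -/
def slotFactor (k : ℝ) (e : X.E) (v : Fin 3 → X.E) : ℝ :=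
  ‖X.τ₀ e‖ ^ 2 * (min 1 (‖X.τ₀ e‖ ^ 2)) ^ (-k) * Real.exp (-(Real.pi * (max 0 (‖X.τ₀ e‖ ^ 2 - 1) * X.tauSize v))) *
    Real.exp (-(Real.pi * ∑ σ ∈ X.defEmb, (‖σ e‖ ^ 2 - 1) * X.defQuad σ v))

/-- The shrinking majorant is `A` times the product of the slot factors. -/
theorem shrinkMaj_eq_prod (A k : ℝ) (ε : Fin 4 → X.E) (x : X.Tuple) :
    X.shrinkMaj A k ε x = A * ∏ j, X.slotFactor k (ε j) (x j) := by
  unfold shrinkMaj slotFactor defSize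
  have e1 : Real.exp (-(Real.pi * ∑ j, max 0 (‖X.τ₀ (ε j)‖ ^ 2 - 1) * X.tauSize (x j))) =
      ∏ j, Real.exp (-(Real.pi * (max 0 (‖X.τ₀ (ε j)‖ ^ 2 - 1) * X.tauSize (x j)))) := by
    rw [Finset.mul_sum, ← Finset.sum_neg_distrib, Real.exp_sum]
  have e2 : Real.exp (-(Real.pi * ∑ j, ∑ σ ∈ Finset.univ.filter (fun σ : X.E →+* ℂ => σ ≠ X.τ₀ ∧ σ ≠ conjEmb X.τ₀),
      (‖σ (ε j)‖ ^ 2 - 1) * X.defQuad σ (x j))) =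
      ∏ j, Real.exp (-(Real.pi * ∑ σ ∈ X.defEmb, (‖σ (ε j)‖ ^ 2 - 1) * X.defQuad σ (x j))) := by
    rw [Finset.mul_sum, ← Finset.sum_neg_distrib, Real.exp_sum]
    rfl
  rw [e1, e2]
  simp only [Finset.prod_mul_distrib]
  ring

/-- **THE SHRINKING MAJORANT OF AN INTEGRAL COPY IS GAUSSIAN IN THE HOUSES OF ITS SCALARS.** For a centre with non-zero
slots (so `tauSize > 0`) and definite sizes `≥ q_min > 0`, there are `C` and `κ > 0` with
`shrinkMaj A k ε x ≤ C · exp(−κ Σ_j ‖mixedEmbedding X.E (ε j)‖²)` for every tuple of non-zero algebraic integers `ε`. -/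
theorem shrinkMaj_le_gauss (A k : ℝ) (hA : 0 ≤ A) (hk : 0 ≤ k) (x : X.Tuple) (hx : ∀ j, x j ≠ 0) {qm : ℝ}
    (hqm : 0 < qm) (hq : ∀ j, ∀ σ ∈ X.defEmb, qm ≤ X.defQuad σ (x j)) :
    ∃ C κ : ℝ, 0 < κ ∧ ∀ ε : Fin 4 → X.E, (∀ j, IsIntegral ℤ (ε j)) → (∀ j, ε j ≠ 0) →
      X.shrinkMaj A k ε x ≤ C * Real.exp (-(κ * ∑ j, ‖mixedEmbedding X.E (ε j)‖ ^ 2)) := by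
  -- the smallest `τ₀`-size of the centre
  set hmin : ℝ := Finset.univ.inf' Finset.univ_nonempty (fun j => X.tauSize (x j)) with hhmin
  have hmin_pos : 0 < hmin := by
    rw [hhmin, Finset.lt_inf'_iff]
    exact fun j _ => X.tauSize_pos (hx j)
  have hmin_le : ∀ j, hmin ≤ X.tauSize (x j) := fun j =>
    Finset.inf'_le (fun j => X.tauSize (x j)) (Finset.mem_univ j)
  set κ : ℝ := Real.pi / 2 * min hmin qm with hκ
  have hκ0 : 0 < κ := by positivity
  -- the per-slot constants
  have hslot : ∀ j, ∃ C : ℝ, 0 ≤ C ∧ ∀ (t : ℝ) (u : (X.E →+* ℂ) → ℝ), 0 < t → (∀ σ ∈ X.defEmb, 0 ≤ u σ) →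
      1 ≤ t ^ 2 * ∏ σ ∈ X.defEmb, u σ →
      t ^ 2 * (min 1 (t ^ 2)) ^ (-k) * Real.exp (-(Real.pi * (max 0 (t ^ 2 - 1) * X.tauSize (x j)))) *
        Real.exp (-(Real.pi * ∑ σ ∈ X.defEmb, (u σ ^ 2 - 1) * X.defQuad σ (x j))) ≤
      C * Real.exp (-(κ * (t ^ 2 + ∑ σ ∈ X.defEmb, u σ ^ 2))) := by
    intro j
    refine slot_gauss_bound X.defEmb (X.tauSize_pos (hx j)) hqm hk ?_ ?_ (fun σ => X.defQuad σ (x j)) (hq j)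
    · rw [hκ]
      have := hmin_le j
      have h2 : min hmin qm ≤ hmin := min_le_left _ _
      nlinarith [Real.pi_pos]
    · rw [hκ]
      have h2 : min hmin qm ≤ qm := min_le_right _ _
      nlinarith [Real.pi_pos]
  choose C hC0 hC using hslot
  refine ⟨A * ∏ j, C j, κ, hκ0, fun ε hint hne => ?_⟩
  rw [X.shrinkMaj_eq_prod]
  -- each slot
  have hj : ∀ j, X.slotFactor k (ε j) (x j) ≤
      C j * Real.exp (-(κ * (‖X.τ₀ (ε j)‖ ^ 2 + ∑ σ ∈ X.defEmb, ‖σ (ε j)‖ ^ 2))) := fun j =>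
    hC j (‖X.τ₀ (ε j)‖) (fun σ => ‖σ (ε j)‖) (norm_pos_iff.2 ((map_ne_zero _).2 (hne j)))
      (fun σ _ => norm_nonneg _) (X.one_le_tau_sq_mul_prod_def (hint j) (hne j))
  have hj' : ∀ j, C j * Real.exp (-(κ * (‖X.τ₀ (ε j)‖ ^ 2 + ∑ σ ∈ X.defEmb, ‖σ (ε j)‖ ^ 2))) ≤
      C j * Real.exp (-(κ * ‖mixedEmbedding X.E (ε j)‖ ^ 2)) := fun j => by
    refine mul_le_mul_of_nonneg_left (Real.exp_le_exp.2 ?_) (hC0 j)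
    have := X.mixed_norm_sq_le (ε j)
    nlinarith
  have hslot0 : ∀ j, 0 ≤ X.slotFactor k (ε j) (x j) := fun j => by
    unfold slotFactor
    have : 0 ≤ (min 1 (‖X.τ₀ (ε j)‖ ^ 2)) ^ (-k) := Real.rpow_nonneg (by positivity) _
    positivity
  calc A * ∏ j, X.slotFactor k (ε j) (x j)
      ≤ A * ∏ j, (C j * Real.exp (-(κ * ‖mixedEmbedding X.E (ε j)‖ ^ 2))) := by
        refine mul_le_mul_of_nonneg_left ?_ hA
        exact Finset.prod_le_prod (fun i _ => hslot0 i) (fun i _ => (hj i).trans (hj' i))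
    _ = A * (∏ j, C j) * Real.exp (-(κ * ∑ j, ‖mixedEmbedding X.E (ε j)‖ ^ 2)) := by
        rw [Finset.prod_mul_distrib, Finset.mul_sum, ← Finset.sum_neg_distrib, Real.exp_sum]
        ring

end T4Data

end Summit.Ventures.HodgeRepro.Tier4.Line3

end
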